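import Summits.Ventures.CertifiedArithmetic.LowPrec.DoubleRoundingFMABinadeIff

/-!
# Double rounding of the FMA — every binade above `W` decided exactly (THEOREM D-fma-M∞): the
# ladder test and its integer core

HONEST FRAMING: certified error envelopes and provably optimal rounding/accumulation schemes for
low-precision formats under stated cost models; every table by two implementations; no hardware
or vendor claims.

THEOREM D-fma-M♯ (`DoubleRoundingFMABinadeIff.lean`) decides `DFma φ ψ` on the middle columns
`m + 2 ≤ n ≤ 2m` (`n = m_ψ - m_φ`) for a source maximum in the FIRST binade above
`W = 2^(m+1+k)·quantum φ` (`k + m + bias φ = n + 1`).  This packet climbs the whole ladder: a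
source maximum `M_φ = (2^m + J)·2^(k+i+1)` quanta in the binade `i ≥ 0` above `W`, `J ≤ 2^m`.
THE TEST `fmaLadderTest m n i J`: some midpoint `μ_t = (2t+1)·2^(k+i')·quantum φ` of a binade
`i' ≤ i` (`t = 2^m + j` visible: `(2t+1)·2^i' < (2^m+J)·2^(i+1)`), a rung depth `g ≤ i'`, an odd
`d₁ ≤ 2^g` and an offset count `|e| ≤ 2^(2m+2-n-g)` such that the addend significand
`w = 2t + 1 - e` is in range (`w·2^i' ≤ (2^m+J)·2^(i+1)`) and SHAPED (`fmaShape`: `w < 2^(m+1)`,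
or `w` even below `2^(m+2)`, or `4 ∣ w` — exactly "`w·2^K` is a value of `φ`" for `w < 2^(m+3)`),
and `|e·2^(n+g) ± d₁| = a₁·b₁` is a product of two `P_φ`-digit significands (`twoSigTest`; sign
`+` for `t` even, `-` for `t` odd).  The slip datum is `a = ±a₁·2^(i'-g)`, `b = b₁`,
`c = w·2^(k+i')` quanta: `a·b + c = μ_t ± d₁·2^(i'-g)·quantum φ²`, within half an ulp of `ψ`
(`2^i'·quantum φ²`) of `μ_t`, so `fl_ψ` lands ON the midpoint (a tie only at `g = 0`, resolved onto
`μ_t`, whose `ψ`-significand is even) and `fl_φ` of the midpoint is the even neighbour, of the sum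
the other one.  Rung `(i', g) = (0, 0)` is `fmaBinadeSlipTest m n J` verbatim.

THIS FILE: the test (§1), the shape lemmas (§2) and THE INTEGER CORE of soundness (§3,
`ladder_core`): given the slip equation `A·B + C·2^s = (2t+1)·2^(n+i') + N` (`s = m + bias - 1`,
`k + s = n`) with `0 < |N| ≤ 2^i'`, the sign of `N` tied to the parity of `t`, `|A|, |B|, C`
significand-shaped and `C` in range, and the window condition `i + 1 ≤ s`, the test passes —
the 2-adic bookkeeping: `N = ±2^v·d₁`, everything else in the equation is divisible by `2^(i'+1)`,
so `A·B` has valuation exactly `v` (`two_adic_match`), `|A·B| = 2^v·a₁·b₁ < 2^(m+n+i')`,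
`C > 2^(m+k+i')`, `C = w·2^(k+i')`, `a₁·b₁ = |e·2^(n+g) ± d₁|` with `g = i' - v`.  The frame
(`ladder_slip_sig`) is `DoubleRoundingFMALadderFrame.lean`, the decision and the universal cap
`DoubleRoundingFMALadderIff.lean`.  Implementation A: `code/enum/fma_ladder_law.py` →
`DOUBLE-ROUNDING-FMA.md` §15, `certs/enum/DOUBLE-ROUNDING-FMA-LADDER.json`.  PLACEMENT:
innocuous double rounding [Figueroa1995] §3, [Roux2014] §2; FMA by rounding to odd
[BoldoMelquiond2008] Thm 3; the midpoint property of a slip [MartinDorelMelquiondMuller2013]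
Property 2.1; we found no record-level decision of the FMA through a `2P+1 … 3P-2`-digit register
over all source ranges in the literature searched (queries in the cell's notes).  No hardware or
vendor claims.
-/

namespace Summit.Ventures.CertifiedArithmetic

open Literature.ComputerArithmetic.FloatingPoint
open Literature.ComputerArithmetic.FloatingPoint.Format
open Literature.ComputerArithmetic.FloatingPoint.MiniFloat

/-! ## §1 The test -/

/-- `fmaShape m w`: the addend significand `w` is a `P_φ`-digit significand times a power of two —
`w < 2^(m+1)`, or `w` even and `w < 2^(m+2)`, or `4 ∣ w`; exact for `w < 2^(m+3)` (the test only
meets such `w`). [this packet] -/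
def fmaShape (m : ℕ) (w : ℤ) : Bool :=
  decide (w < 2 ^ (m + 1)) || (decide (w % 2 = 0) && decide (w < 2 ^ (m + 2)))
    || decide (w % 4 = 0)

/-- One candidate of the ladder test: binade `i' ≤ i` of the slipping midpoint, midpoint index `j`
(`t = 2^m + j`; offset sign `+` for `j` even, `-` for `j` odd), rung depth `g`, odd offset
`d₁ ≤ 2^g` and offset count `e`; conditions: `μ_t` visible (`(2t+1)·2^i' < (2^m+J)·2^(i+1)`), the addend
significand `w = 2t + 1 - e` at least `2^m`, in range (`w·2^i' ≤ (2^m+J)·2^(i+1)`) and shaped, and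
`|e·2^(n+g) ± d₁|` a product of two `P_φ`-digit significands. [this packet] -/
def fmaLadderCond (m n i J i' j g d₁ : ℕ) (e : ℤ) : Bool :=
  decide ((2 * (2 ^ m + j) + 1) * 2 ^ i' < (2 ^ m + J) * 2 ^ (i + 1))
    && decide ((2:ℤ) ^ m ≤ 2 * (2 ^ m + j) + 1 - e)
    && decide ((2 * ((2:ℤ) ^ m + j) + 1 - e) * 2 ^ i' ≤ (2 ^ m + J) * 2 ^ (i + 1))
    && fmaShape m (2 * ((2:ℤ) ^ m + j) + 1 - e)
    && decide (d₁ % 2 = 1) && decide (d₁ ≤ 2 ^ g)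
    && twoSigTest (m + 1)
        (e * 2 ^ (n + g) + (if j % 2 = 0 then (d₁ : ℤ) else -(d₁ : ℤ))).natAbs

/-- `fmaLadderTest m n i J`: some binade `i' ≤ i`, midpoint `j < 2^m`, rung depth `g ≤ i'`, offset
`d₁ ≤ 2^g` and offset count `|e| ≤ 2^(2m+2-n-g)` pass `fmaLadderCond` — the FMA of an
`(m+1)`-digit source with `M = (2^m + J)·2^(k+i+1)` quanta through an `(m+n+1)`-digit register
slips somewhere. [this packet] -/
def fmaLadderTest (m n i J : ℕ) : Bool :=
  (List.range (i + 1)).any fun i' =>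
    (List.range (2 ^ m)).any fun j =>
      (List.range (i' + 1)).any fun g =>
        (List.range (2 ^ g + 1)).any fun d₁ =>
          (List.range (2 * 2 ^ (2 * m + 2 - n - g) + 1)).any fun u =>
            fmaLadderCond m n i J i' j g d₁ ((u : ℤ) - 2 ^ (2 * m + 2 - n - g))

/-- Reading a passing candidate back into the test. [this packet] -/
theorem fmaLadderTest_eq_true_of {m n i J i' j g d₁ : ℕ} {e : ℤ} (hi' : i' ≤ i)
    (hj : j < 2 ^ m) (hg : g ≤ i') (hd : d₁ ≤ 2 ^ g) (he : |e| ≤ 2 ^ (2 * m + 2 - n - g))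
    (h : fmaLadderCond m n i J i' j g d₁ e = true) : fmaLadderTest m n i J = true := by
  unfold fmaLadderTest
  simp only [List.any_eq_true, List.mem_range]
  have hE : (((2 ^ (2 * m + 2 - n - g) : ℕ) : ℤ)) = (2:ℤ) ^ (2 * m + 2 - n - g) := by
    push_cast; rfl
  rw [← hE] at he
  obtain ⟨he1, he2⟩ := abs_le.mp he
  refine ⟨i', by omega, j, hj, g, by omega, d₁, by omega,
    (e + ((2 ^ (2 * m + 2 - n - g) : ℕ) : ℤ)).toNat, by omega, ?_⟩
  rw [Int.toNat_of_nonneg (by omega)]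
  convert h using 2; push_cast; ring

/-- Reading the test: a passing candidate with its bounds. [this packet] -/
theorem exists_of_fmaLadderTest {m n i J : ℕ} (h : fmaLadderTest m n i J = true) :
    ∃ i' j g d₁ : ℕ, ∃ e : ℤ, i' ≤ i ∧ j < 2 ^ m ∧ g ≤ i' ∧ d₁ ≤ 2 ^ g ∧
      |e| ≤ 2 ^ (2 * m + 2 - n - g) ∧ fmaLadderCond m n i J i' j g d₁ e = true := by
  unfold fmaLadderTest at h
  simp only [List.any_eq_true, List.mem_range] at h
  obtain ⟨i', hi', j, hj, g, hg, d₁, hd, u, hu, hc⟩ := h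
  refine ⟨i', j, g, d₁, (u : ℤ) - 2 ^ (2 * m + 2 - n - g), by omega, hj, by omega, by omega,
    ?_, hc⟩
  have hu' : (u : ℤ) < 2 * (2:ℤ) ^ (2 * m + 2 - n - g) + 1 := by exact_mod_cast hu
  have h0 : (0:ℤ) ≤ u := by positivity
  rw [abs_le]; constructor <;> linarith

/-- MONOTONICITY IN THE SOURCE RANGE: a slip below `2^i·(W + 2J·h)` is a slip below every larger
maximum `2^i'·(W + 2J'·h)`, `(i, J) ≤ (i', J')` lexicographically, `J ≤ 2^m`. [this packet] -/
theorem fmaLadderTest_mono {m n i J i₂ J₂ : ℕ} (hJ : J ≤ 2 ^ m)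
    (hle : i < i₂ ∨ (i = i₂ ∧ J ≤ J₂)) (h : fmaLadderTest m n i J = true) :
    fmaLadderTest m n i₂ J₂ = true := by
  obtain ⟨i', j, g, d₁, e, hi', hj, hg, hd, he, hc⟩ := exists_of_fmaLadderTest h
  have hii : i ≤ i₂ := by rcases hle with h0 | ⟨h0, -⟩ <;> omega
  refine fmaLadderTest_eq_true_of (hi'.trans hii) hj hg hd he ?_
  simp only [fmaLadderCond, Bool.and_eq_true, decide_eq_true_eq] at hc ⊢
  obtain ⟨⟨⟨⟨⟨⟨hv, hw1⟩, hw2⟩, hsh⟩, hd1⟩, hd2⟩, hsig⟩ := hc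
  have hB : (2 ^ m + J) * 2 ^ (i + 1) ≤ (2 ^ m + J₂) * 2 ^ (i₂ + 1) := by
    rcases hle with h0 | ⟨rfl, h0⟩
    · calc (2 ^ m + J) * 2 ^ (i + 1) ≤ (2 ^ m + 2 ^ m) * 2 ^ (i + 1) :=
            Nat.mul_le_mul_right _ (by omega)
        _ = 2 ^ m * 2 ^ (i + 2) := by rw [← two_mul, pow_succ 2 (i + 1)]; ring
        _ ≤ (2 ^ m + J₂) * 2 ^ (i₂ + 1) :=
            Nat.mul_le_mul (Nat.le_add_right _ _) (Nat.pow_le_pow_right (by norm_num) (by omega))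
    · exact Nat.mul_le_mul_right _ (by omega)
  have hBz : ((2:ℤ) ^ m + J) * 2 ^ (i + 1) ≤ (2 ^ m + J₂) * 2 ^ (i₂ + 1) := by exact_mod_cast hB
  exact ⟨⟨⟨⟨⟨⟨lt_of_lt_of_le hv hB, hw1⟩, hw2.trans hBz⟩, hsh⟩, hd1⟩, hd2⟩, hsig⟩

/-! ## §2 The shape of an addend significand -/

/-- A significand times a power of two is shaped. [folklore] -/
theorem fmaShape_natMul_pow {m s l : ℕ} (hs : s < 2 ^ (m + 1)) :
    fmaShape m ((s * 2 ^ l : ℕ) : ℤ) = true := by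
  simp only [fmaShape, Bool.or_eq_true, Bool.and_eq_true, decide_eq_true_eq]
  rcases l with _ | _ | l
  · left; left; rw [pow_zero, mul_one]; exact_mod_cast hs
  · left; right
    refine ⟨?_, ?_⟩
    · have e0 : ((s * 2 ^ 1 : ℕ) : ℤ) = (s : ℤ) * 2 := by push_cast; ring
      rw [e0]; exact Int.mul_emod_left _ _
    · have : s * 2 ^ 1 < 2 ^ (m + 2) := by rw [pow_one, pow_succ]; omega
      exact_mod_cast this
  · right
    have e1 : ((s * 2 ^ (l + 2) : ℕ) : ℤ) = (s * 2 ^ l : ℕ) * 4 := by push_cast; ring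
    rw [e1]; exact Int.mul_emod_left _ _

/-- A shaped `w < 2^(m+3)` is a significand times `1`, `2` or `4`. [folklore] -/
theorem exists_of_fmaShape {m w : ℕ} (h : fmaShape m (w : ℤ) = true) (hw : w < 2 ^ (m + 3)) :
    ∃ s l : ℕ, w = s * 2 ^ l ∧ s < 2 ^ (m + 1) := by
  simp only [fmaShape, Bool.or_eq_true, Bool.and_eq_true, decide_eq_true_eq] at h
  have h4 : 2 ^ (m + 2) = 2 ^ (m + 1) * 2 := pow_succ 2 (m + 1)
  have h8 : 2 ^ (m + 3) = 2 ^ (m + 1) * 4 := by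
    rw [show m + 3 = (m + 1) + 2 by omega, pow_add 2 (m + 1) 2]; norm_num
  rcases h with (h0 | ⟨h2, h3⟩) | h5
  · exact ⟨w, 0, by simp, by exact_mod_cast h0⟩
  · have h2' : w % 2 = 0 := by exact_mod_cast h2
    have h3' : w < 2 ^ (m + 2) := by exact_mod_cast h3
    exact ⟨w / 2, 1, by omega, by omega⟩
  · have h5' : w % 4 = 0 := by exact_mod_cast h5
    exact ⟨w / 4, 2, by norm_num; omega, by omega⟩

/-! ## §3 The integer core of soundness -/

/-- The odd part of a nonzero `s·2^j`, `s < 2^(m+1)`, is a significand: `N = 2^v·a₁`, `a₁` odd,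
`0 < a₁ < 2^(m+1)`. [folklore] -/
theorem exists_oddPart_of_sig {m s j N : ℕ} (hs : s < 2 ^ (m + 1)) (hN : N = s * 2 ^ j)
    (hN0 : N ≠ 0) : ∃ v a₁ : ℕ, Odd a₁ ∧ N = 2 ^ v * a₁ ∧ a₁ < 2 ^ (m + 1) ∧ 0 < a₁ := by
  have hs0 : s ≠ 0 := by rintro rfl; rw [zero_mul] at hN; exact hN0 hN
  obtain ⟨p, a₁, hodd, hsp⟩ := Nat.exists_eq_two_pow_mul_odd hs0
  refine ⟨j + p, a₁, hodd, by rw [hN, hsp, pow_add]; ring, lt_of_le_of_lt ?_ hs, hodd.pos⟩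
  rw [hsp]; exact Nat.le_mul_of_pos_left a₁ (by positivity)

/-- 2-ADIC MATCHING: if `2^r ∣ X - Y` with `|X| = 2^V·x`, `|Y| = 2^v·y`, `x`, `y` odd and `v < r`,
then `V = v`. [folklore] -/
theorem two_adic_match {X Y : ℤ} {V v r x y : ℕ} (hx : Odd x) (hy : Odd y)
    (hX : X.natAbs = 2 ^ V * x) (hY : Y.natAbs = 2 ^ v * y) (hvr : v < r)
    (h : (2:ℤ) ^ r ∣ X - Y) : V = v := by
  have h2w : ∀ i : ℕ, ((2:ℤ) ^ i).natAbs = 2 ^ i := fun i => by rw [Int.natAbs_pow]; rfl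
  have toZ : ∀ {i : ℕ} {Z : ℤ}, 2 ^ i ∣ Z.natAbs → (2:ℤ) ^ i ∣ Z := fun {i Z} hd =>
    Int.natAbs_dvd_natAbs.mp (by rwa [h2w])
  have toN : ∀ {i : ℕ} {Z : ℤ}, (2:ℤ) ^ i ∣ Z → 2 ^ i ∣ Z.natAbs := fun {i Z} hd => by
    have := Int.natAbs_dvd_natAbs.mpr hd; rwa [h2w] at this
  by_contra hne
  rcases Nat.lt_or_gt_of_ne hne with hlt | hgt
  · -- `V < v`: `2^(V+1)` divides `Y` and `X - Y`, hence `X = 2^V·x`: `x` even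
    have h1 : (2:ℤ) ^ (V + 1) ∣ Y :=
      toZ (by rw [hY]; exact Dvd.dvd.mul_right (pow_dvd_pow 2 (by omega)) _)
    have h2 : (2:ℤ) ^ (V + 1) ∣ X - Y := (pow_dvd_pow 2 (by omega)).trans h
    have h3 : (2:ℤ) ^ (V + 1) ∣ X := by
      have := dvd_add h2 h1; rwa [sub_add_cancel] at this
    have h4 : 2 ^ (V + 1) ∣ 2 ^ V * x := hX ▸ toN h3
    rw [pow_succ] at h4
    exact hx.not_two_dvd_nat (Nat.dvd_of_mul_dvd_mul_left (by positivity) h4)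
  · -- `v < V`: `2^(v+1)` divides `X` and `X - Y`, hence `Y = 2^v·y`: `y` even
    have h1 : (2:ℤ) ^ (v + 1) ∣ X :=
      toZ (by rw [hX]; exact Dvd.dvd.mul_right (pow_dvd_pow 2 (by omega)) _)
    have h2 : (2:ℤ) ^ (v + 1) ∣ X - Y := (pow_dvd_pow 2 (by omega)).trans h
    have h3 : (2:ℤ) ^ (v + 1) ∣ Y := by
      have := dvd_sub h1 h2; rwa [sub_sub_cancel] at this
    have h4 : 2 ^ (v + 1) ∣ 2 ^ v * y := hY ▸ toN h3
    rw [pow_succ] at h4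
    exact hy.not_two_dvd_nat (Nat.dvd_of_mul_dvd_mul_left (by positivity) h4)

/-- THE INTEGER CORE OF THE LADDER (soundness of `fmaLadderTest`).  Significands of `m+1` digits,
register excess `n ≥ m + 2`, `k + s = n` (`s = m + bias - 1`, `2^s = 1/quantum φ`), source maximum
`(2^m + J)·2^(k+i+1)` with the window condition `i + 1 ≤ s`; a slip at the midpoint `t` of binade
`i' ≤ i` (`t + 1` visible) reads `A·B + C·2^s = (2t+1)·2^(n+i') + N` with `0 < |N| ≤ 2^i'`, `N > 0`
iff `t` even, `|A| = sa·2^ja`, `|B| = sb·2^jb`, `|C| = sc·2^jc` (`sa, sb, sc < 2^(m+1)`, `A·B ≠ 0`)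
and `C ≤ (2^m + J)·2^(k+i+1)`.  Then the test passes. [this packet] -/
theorem ladder_core {m n k s i J i' t : ℕ} {A B C N : ℤ} (h1 : 1 ≤ m) (hn2 : m + 2 ≤ n)
    (hks : k + s = n) (his : i + 1 ≤ s) (hi' : i' ≤ i) (htlo : 2 ^ m ≤ t)
    (hthi : t < 2 ^ (m + 1)) (hvis : (t + 1) * 2 ^ (k + i' + 1) ≤ (2 ^ m + J) * 2 ^ (k + i + 1))
    (hN : N = A * B + C * 2 ^ s - (2 * t + 1) * 2 ^ (n + i')) (hN0 : N ≠ 0)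
    (hNle : |N| ≤ 2 ^ i') (hsgn : (Even t → 0 < N) ∧ (Odd t → N < 0))
    {sa ja sb jb sc jc : ℕ} (hsa : sa < 2 ^ (m + 1)) (hA : A.natAbs = sa * 2 ^ ja) (hA0 : A ≠ 0)
    (hsb : sb < 2 ^ (m + 1)) (hB : B.natAbs = sb * 2 ^ jb) (hB0 : B ≠ 0)
    (hsc : sc < 2 ^ (m + 1)) (hC : C.natAbs = sc * 2 ^ jc)
    (hCM : C ≤ (2 ^ m + J) * 2 ^ (k + i + 1)) :
    fmaLadderTest m n i J = true := by
  -- (1) odd parts: `|A| = 2^va·a₁`, `|B| = 2^vb·b₁`, `|N| = 2^v·d₁`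
  obtain ⟨va, a₁, ha₁o, hAv, ha₁, ha₁0⟩ :=
    exists_oddPart_of_sig hsa hA (Int.natAbs_ne_zero.mpr hA0)
  obtain ⟨vb, b₁, hb₁o, hBv, hb₁, hb₁0⟩ :=
    exists_oddPart_of_sig hsb hB (Int.natAbs_ne_zero.mpr hB0)
  obtain ⟨v, d₁, hd₁o, hNv⟩ := Nat.exists_eq_two_pow_mul_odd (Int.natAbs_ne_zero.mpr hN0)
  have hABv : (A * B).natAbs = 2 ^ (va + vb) * (a₁ * b₁) := by
    rw [Int.natAbs_mul, hAv, hBv, pow_add]; ring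
  -- (2) the valuation of `A·B` is `v`: `A·B - N = (2t+1)·2^(n+i') - C·2^s`, both divisible by
  -- `2^(i'+1)` (`i' + 1 ≤ s`, `i' + 1 ≤ n + i'`), and `v ≤ i'`
  have hvi : v ≤ i' := by
    have h2 : 2 ^ v ≤ 2 ^ i' := by
      have h3 : 2 ^ v * d₁ ≤ 2 ^ i' := by
        have : ((N.natAbs : ℕ) : ℤ) ≤ 2 ^ i' := by rw [Int.natCast_natAbs]; exact hNle
        rw [hNv] at this; exact_mod_cast this
      exact le_trans (Nat.le_mul_of_pos_right _ hd₁o.pos) h3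
    exact (Nat.pow_le_pow_iff_right (by norm_num)).mp h2
  have hdiv : (2:ℤ) ^ (i' + 1) ∣ A * B - N := by
    have e1 : A * B - N = (2 * t + 1) * 2 ^ (n + i') - C * 2 ^ s := by rw [hN]; ring
    rw [e1]
    exact dvd_sub (Dvd.dvd.mul_left (pow_dvd_pow 2 (by omega)) _)
      (Dvd.dvd.mul_left (pow_dvd_pow 2 (by omega)) _)
  have hV : va + vb = v := two_adic_match (ha₁o.mul hb₁o) hd₁o hABv hNv (by omega) hdiv
  -- (3) `|A·B| = 2^v·a₁·b₁ < 2^(m+n+i')`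
  have hP : (2:ℤ) ^ (m + 1) * 2 ^ (m + 1) = 2 ^ (2 * m + 2) := by rw [← pow_add]; ring_nf
  have hab4 : ((a₁ * b₁ : ℕ) : ℤ) < 2 ^ (2 * m + 2) := by
    have : a₁ * b₁ < 2 ^ (m + 1) * 2 ^ (m + 1) :=
      Nat.mul_lt_mul_of_lt_of_le ha₁ hb₁.le (by positivity)
    rw [← hP]; exact_mod_cast this
  have hABabs : |A * B| = 2 ^ v * ((a₁ * b₁ : ℕ) : ℤ) := by
    rw [Int.abs_eq_natAbs, hABv, hV]; push_cast; ring
  have hABlt : |A * B| < 2 ^ (m + n + i') := by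
    rw [hABabs]
    calc (2:ℤ) ^ v * ((a₁ * b₁ : ℕ) : ℤ) < 2 ^ v * 2 ^ (2 * m + 2) :=
          mul_lt_mul_of_pos_left hab4 (by positivity)
      _ = 2 ^ (v + (2 * m + 2)) := (pow_add 2 v (2 * m + 2)).symm
      _ ≤ 2 ^ (m + n + i') := pow_le_pow_right₀ (by norm_num) (by omega)
  -- (4) `C·2^s > 2^(m+n+i') = 2^(m+k+i')·2^s`: `C > 2^(m+k+i')`
  have h2s : (0:ℤ) < 2 ^ s := by positivity
  have hCs : (2:ℤ) ^ (m + n + i') < C * 2 ^ s := by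
    have e1 : C * 2 ^ s = N + (2 * t + 1) * 2 ^ (n + i') - A * B := by rw [hN]; ring
    rw [e1]
    have htz : (2:ℤ) ^ m ≤ t := by exact_mod_cast htlo
    have ht2 : (2:ℤ) ^ (m + n + i') * 2 + 2 ^ (n + i') ≤ (2 * (t:ℤ) + 1) * 2 ^ (n + i') := by
      have h7 : (2:ℤ) ^ m * 2 ^ (n + i') ≤ (t:ℤ) * 2 ^ (n + i') :=
        mul_le_mul_of_nonneg_right htz (by positivity)
      have e2 : (2:ℤ) ^ (m + n + i') = 2 ^ m * 2 ^ (n + i') := by rw [← pow_add]; ring_nf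
      rw [e2]; linarith
    have hNl : -(2:ℤ) ^ i' ≤ N := (abs_le.mp hNle).1
    have hi2 : (2:ℤ) ^ i' ≤ 2 ^ (n + i') := pow_le_pow_right₀ (by norm_num) (by omega)
    have hABl := (abs_lt.mp hABlt).2
    linarith
  have hC0 : 0 < C := (mul_pos_iff_of_pos_right h2s).mp (lt_trans (by positivity) hCs)
  have hCnat : ((C.natAbs : ℕ) : ℤ) = C := Int.natAbs_of_nonneg hC0.le
  have hClt : 2 ^ (m + k + i') < sc * 2 ^ jc := by
    have e2 : (2:ℤ) ^ (m + n + i') = 2 ^ (m + k + i') * 2 ^ s := by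
      rw [← pow_add]; congr 1; omega
    have h4 : (2:ℤ) ^ (m + k + i') * 2 ^ s < ((sc * 2 ^ jc : ℕ) : ℤ) * 2 ^ s := by
      rw [← e2, ← hC, hCnat]; exact hCs
    exact_mod_cast lt_of_mul_lt_mul_right h4 h2s.le
  -- (5) `C = w·2^(k+i')`, `w = sc·2^l` shaped, `2^m < w`, `w·2^i' ≤ (2^m+J)·2^(i+1)`
  have hjc : k + i' ≤ jc := by
    by_contra hlt
    push Not at hlt
    have : sc * 2 ^ jc < 2 ^ (m + k + i') :=
      calc sc * 2 ^ jc < 2 ^ (m + 1) * 2 ^ jc := Nat.mul_lt_mul_of_pos_right hsc (by positivity)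
        _ = 2 ^ (m + 1 + jc) := by rw [← pow_add]
        _ ≤ 2 ^ (m + k + i') := Nat.pow_le_pow_right (by norm_num) (by omega)
    omega
  obtain ⟨l, hl⟩ := Nat.exists_eq_add_of_le hjc
  set w : ℕ := sc * 2 ^ l with hwdef
  have hCw : C = (w : ℤ) * 2 ^ (k + i') := by
    rw [← hCnat, hC, hl, hwdef]; push_cast; rw [pow_add]; ring
  have hwsh : fmaShape m (w : ℤ) = true := fmaShape_natMul_pow hsc
  have hwlo : (2:ℤ) ^ m < w := by
    have h5 : (2:ℤ) ^ (m + k + i') < (w : ℤ) * 2 ^ (k + i') := by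
      rw [← hCw, ← hCnat, hC]; exact_mod_cast hClt
    have e2 : (2:ℤ) ^ (m + k + i') = 2 ^ m * 2 ^ (k + i') := by rw [← pow_add]; ring_nf
    rw [e2] at h5
    exact lt_of_mul_lt_mul_right h5 (by positivity)
  have hwhi : (w : ℤ) * 2 ^ i' ≤ (2 ^ m + J) * 2 ^ (i + 1) := by
    have h5 : (w : ℤ) * 2 ^ i' * 2 ^ k ≤ (2 ^ m + J) * 2 ^ (i + 1) * 2 ^ k := by
      have e3 : (w : ℤ) * 2 ^ i' * 2 ^ k = C := by rw [hCw, pow_add]; ring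
      have e4 : ((2:ℤ) ^ m + J) * 2 ^ (i + 1) * 2 ^ k = (2 ^ m + J) * 2 ^ (k + i + 1) := by
        rw [show k + i + 1 = (i + 1) + k by omega, pow_add]; ring
      rw [e3, e4]; exact_mod_cast hCM
    exact le_of_mul_le_mul_right h5 (by positivity)
  -- (6) `A·B = e·2^(n+i') + N` with `e = 2t + 1 - w`; `N = σ·2^v·d₁`, `σ` by the parity of `t`
  set e : ℤ := 2 * (t:ℤ) + 1 - w with hedef
  have hAB : A * B = e * 2 ^ (n + i') + N := by
    have e1 : C * 2 ^ s = (w : ℤ) * 2 ^ (n + i') := by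
      rw [hCw, show n + i' = (k + i') + s by omega, pow_add _ (k + i') s]; ring
    have e2 : A * B = (2 * (t:ℤ) + 1) * 2 ^ (n + i') + N - C * 2 ^ s := by rw [hN]; ring
    rw [e2, e1, hedef]; ring
  set σ : ℤ := if t % 2 = 0 then 1 else -1 with hσdef
  have hNσ : N = σ * 2 ^ v * d₁ := by
    have hNabs : ((N.natAbs : ℕ) : ℤ) = 2 ^ v * d₁ := by rw [hNv]; push_cast; ring
    rcases Nat.even_or_odd t with hte | hto
    · have hpos := hsgn.1 hte
      have h3 : N = 2 ^ v * d₁ := by rw [← abs_of_pos hpos, ← Int.natCast_natAbs, hNabs]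
      rw [hσdef, if_pos (Nat.even_iff.mp hte)]; linarith
    · have hneg := hsgn.2 hto
      have ht2 : ¬ t % 2 = 0 := by rw [Nat.odd_iff.mp hto]; norm_num
      have h3 : -N = 2 ^ v * d₁ := by rw [← abs_of_neg hneg, ← Int.natCast_natAbs, hNabs]
      rw [hσdef, if_neg ht2]; linarith
  -- (7) dividing by `2^v`: `a₁·b₁ = |e·2^(n+g) + σ·d₁|`, `g = i' - v`
  obtain ⟨g, hg⟩ := Nat.exists_eq_add_of_le hvi
  have hfac : ((a₁ * b₁ : ℕ) : ℤ) = |e * 2 ^ (n + g) + σ * d₁| := by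
    have e1 : (2:ℤ) ^ v * (e * 2 ^ (n + g) + σ * d₁) = A * B := by
      rw [hAB, hNσ, hg, show n + (v + g) = v + (n + g) by ring, pow_add _ v (n + g)]; ring
    have e2 : (2:ℤ) ^ v * |e * 2 ^ (n + g) + σ * d₁| = 2 ^ v * ((a₁ * b₁ : ℕ) : ℤ) := by
      rw [← hABabs, ← e1, abs_mul, abs_of_pos (by positivity : (0:ℤ) < 2 ^ v)]
    exact (mul_left_cancel₀ (by positivity) e2).symm
  -- (8) the bounds: `d₁ ≤ 2^g` (odd), `|e| ≤ 2^(2m+2-n-g)`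
  have hd₁g : d₁ ≤ 2 ^ g := by
    have h3 : 2 ^ v * d₁ ≤ 2 ^ v * 2 ^ g := by
      have : ((N.natAbs : ℕ) : ℤ) ≤ 2 ^ i' := by rw [Int.natCast_natAbs]; exact hNle
      rw [hNv, hg, pow_add] at this; exact_mod_cast this
    exact Nat.le_of_mul_le_mul_left h3 (by positivity)
  have heb : |e| ≤ 2 ^ (2 * m + 2 - n - g) := by
    have h2ng : (0:ℤ) < 2 ^ (n + g) := by positivity
    have hd₁z : (d₁ : ℤ) ≤ 2 ^ g := by exact_mod_cast hd₁g
    have hgng : (2:ℤ) ^ g ≤ 2 ^ (n + g) := pow_le_pow_right₀ (by norm_num) (by omega)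
    have hσ1 : |σ| = 1 := by rw [hσdef]; split_ifs <;> simp
    -- `|e|·2^(n+g) ≤ a₁·b₁ + d₁ < 2^(2m+2) + 2^(n+g) ≤ (2^(2m+2-n-g) + 1)·2^(n+g)`
    have h6 : |e| * 2 ^ (n + g) ≤ ((a₁ * b₁ : ℕ) : ℤ) + d₁ := by
      have h7 : |e * 2 ^ (n + g)| ≤ |e * 2 ^ (n + g) + σ * d₁| + |σ * d₁| := by
        have h7' := abs_sub (e * 2 ^ (n + g) + σ * d₁) (σ * d₁)
        have e6 : e * 2 ^ (n + g) + σ * d₁ - σ * d₁ = e * 2 ^ (n + g) := by ring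
        rwa [e6] at h7'
      rw [abs_mul, abs_of_pos h2ng] at h7
      rw [hfac]
      have h8 : |σ * (d₁:ℤ)| = d₁ := by rw [abs_mul, hσ1, one_mul, Nat.abs_cast]
      linarith
    have h9 : (2:ℤ) ^ (2 * m + 2) ≤ 2 ^ (2 * m + 2 - n - g) * 2 ^ (n + g) := by
      rw [← pow_add]; exact pow_le_pow_right₀ (by norm_num) (by omega)
    have h10 : |e| * 2 ^ (n + g) < (2 ^ (2 * m + 2 - n - g) + 1) * 2 ^ (n + g) := by linarith
    have h11 : |e| < 2 ^ (2 * m + 2 - n - g) + 1 := lt_of_mul_lt_mul_right h10 h2ng.le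
    omega
  -- (9) the midpoint index `j = t - 2^m`, its parity, and the visibility
  have h2m : 2 ^ m % 2 = 0 := Nat.even_iff.mp (Nat.even_pow.mpr ⟨even_two, by omega⟩)
  have hσj : (if (t - 2 ^ m) % 2 = 0 then (d₁ : ℤ) else -(d₁ : ℤ)) = σ * d₁ := by
    rw [hσdef]
    by_cases ht0 : t % 2 = 0
    · have : (t - 2 ^ m) % 2 = 0 := by omega
      rw [if_pos this, if_pos ht0, one_mul]
    · have : ¬ (t - 2 ^ m) % 2 = 0 := by omega
      rw [if_neg this, if_neg ht0]; ring
  have hvis' : (2 * (2 ^ m + (t - 2 ^ m)) + 1) * 2 ^ i' < (2 ^ m + J) * 2 ^ (i + 1) := by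
    rw [Nat.add_sub_cancel' htlo]
    have h5 : (2 * t + 2) * 2 ^ i' ≤ (2 ^ m + J) * 2 ^ (i + 1) := by
      have e3 : (2 * t + 2) * 2 ^ i' * 2 ^ k = (t + 1) * 2 ^ (k + i' + 1) := by
        rw [pow_add, pow_add]; ring
      have e4 : (2 ^ m + J) * 2 ^ (i + 1) * 2 ^ k = (2 ^ m + J) * 2 ^ (k + i + 1) := by
        rw [show k + i + 1 = (i + 1) + k by omega, pow_add _ (i + 1) k]; ring
      exact Nat.le_of_mul_le_mul_right (by rw [e3, e4]; exact hvis) (by positivity)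
    have h6 : (2 * t + 1) * 2 ^ i' < (2 * t + 2) * 2 ^ i' :=
      Nat.mul_lt_mul_of_pos_right (by omega) (by positivity)
    omega
  -- (10) the test
  refine fmaLadderTest_eq_true_of (i' := i') (j := t - 2 ^ m) (g := g) (d₁ := d₁) (e := e)
    hi' (by rw [pow_succ] at hthi; omega) (by omega) hd₁g heb ?_
  have hcast : ((t - 2 ^ m : ℕ) : ℤ) = (t:ℤ) - 2 ^ m := by
    rw [Nat.cast_sub htlo]; push_cast; ring
  have hwe : 2 * ((2:ℤ) ^ m + ((t:ℤ) - 2 ^ m)) + 1 - e = w := by rw [hedef]; ring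
  simp only [fmaLadderCond, Bool.and_eq_true, decide_eq_true_eq, hσj, hcast, hwe]
  refine ⟨⟨⟨⟨⟨⟨hvis', by linarith⟩, hwhi⟩, hwsh⟩, Nat.odd_iff.mp hd₁o⟩, hd₁g⟩, ?_⟩
  have e5 : (e * 2 ^ (n + g) + σ * d₁).natAbs = a₁ * b₁ := by
    have : (((e * 2 ^ (n + g) + σ * d₁).natAbs : ℕ) : ℤ) = ((a₁ * b₁ : ℕ) : ℤ) := by
      rw [Int.natCast_natAbs, hfac]
    exact_mod_cast this
  rw [e5]
  exact twoSigTest_mul_eq_true ha₁0 ha₁ hb₁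

end Summit.Ventures.CertifiedArithmetic
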